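import Mathlib
import HarnessLib

/-!
# Simpson's rule: Peano kernel (4.3.19), error term (2.2.1) = (4.3.20), compound rule (2.2.4)–(2.2.6)
# (Davis–Rabinowitz, *Methods of Numerical Integration*, Sect. 2.2 and Sect. 4.3)

**Statements.** Simpson's functional `S(f) = (b - a)/6 · [f(a) + 4 f((a + b)/2) + f(b)]` ((2.2.2), `simpson`)
is exact on cubics, so Peano's theorem (Sect. 4.3, (4.3.5)–(4.3.6) with `n = 3`) writes its truncation error for
`f ∈ C⁴[a, b]` as an integral of `f⁽⁴⁾` against an explicit kernel:

* (4.3.19) the PEANO KERNEL `K(t) = (1/6) E_x[(x - t)₊³]`: with `u = min(t - a, b - t)` the distance to the nearer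
  end point, `K(t) = u³ (3u - 2(b - a))/72` (`simpsonKernel`; on `[-1, 1]` this is the book's
  `-(1 - t)³(3t + 1)/72` for `0 ≤ t ≤ 1`, `K(-t) = K(t)`, `simpsonKernel_neg_one_one`); `K ≤ 0` on `[a, b]`
  (`simpsonKernel_nonpos`) and `∫_a^b K = -(b - a)⁵/2880` (`integral_simpsonKernel`; `E(x⁴) = 4! ∫ K`, (4.3.14));
* the kernel identity `∫_a^b f - S(f) = ∫_a^b K(t) f⁽⁴⁾(t) dt` (`integral_sub_simpson_eq_integral_kernel`) — the
  proof IS four integrations by parts on each half-panel;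
* (2.2.1) = (4.3.20), by the second Corollary of Peano's theorem ((4.3.12)–(4.3.13), the mean-value theorem for
  integrals with the one-signed weight `K ≤ 0`, `exists_integral_mul_eq_mul_integral_of_nonpos`):
  `∫_a^b f = S(f) - (b - a)⁵/2880 · f⁽⁴⁾(ξ)` for some `ξ ∈ [a, b]` (`integral_eq_simpson_sub_deriv4`), the bound
  `|∫ f - S(f)| ≤ ζ (b - a)⁵/2880` for `|f⁽⁴⁾| ≤ ζ` ((4.3.11); `abs_integral_sub_simpson_le`) and exactness for
  cubics ((2.2.2); `integral_cubic_eq_simpson`);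
* the COMPOUND SIMPSON RULE over `n` panels of width `H = (b - a)/n` (`simpsonRule`; in the book's notation
  `N = 2n` subintervals of length `h = H/2` and weights `h/3 · (1, 4, 2, 4, …, 2, 4, 1)`, (2.2.4),
  `simpsonRule_eq_sum_weights`), its error term (2.2.5)–(2.2.6)
  `∫_a^b f = S_n(f) - (b - a)⁵/(2880 n⁴) · f⁽⁴⁾(ξ) = S_n(f) - (b - a)⁵/(180 N⁴) · f⁽⁴⁾(ξ)`
  (`integral_eq_simpsonRule_sub_deriv4`, `abs_integral_sub_simpsonRule_le`), the Romberg relation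
  `S_n = (4 T_{2n} - T_n)/3` with Mathlib's compound trapezoidal rule (Sect. 6.3 (6.3.3) with `m = 1`: "the values
  `T₁⁽ᵏ⁾` turn out to be exactly those obtained by use of Simpson's rule"; `simpsonRule_eq_trapezoidal`), and the
  one-sided enclosures that the definite sign of the error term gives: `f⁽⁴⁾ ≥ 0 ⇒ ∫ f ≤ S_n(f)`,
  `f⁽⁴⁾ ≤ 0 ⇒ S_n(f) ≤ ∫ f` (`integral_le_simpsonRule`, `simpsonRule_le_integral`).

**Hypotheses.** As in Mathlib's integration-by-parts API (and in the sibling file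
`MidpointTrapezoidPeanoKernel`) the derivatives are an explicit chain of functions `f, f₁, f₂, f₃, f₄` with
`HasDerivAt f (f₁ x) x`, …, `HasDerivAt f₃ (f₄ x) x` on `[a, b]` and `f₄` interval integrable (continuous on
`[a, b]` for the `ξ`-forms); `a ≤ b` throughout (the kernel is written for ordered end points).

**Prior art.** Mathlib has the compound trapezoidal rule and its error bound (`trapezoidal_integral`,
`trapezoidal_error_le`) and nothing on Simpson's rule; the tree's `MidpointTrapezoidPeanoKernel` treats the
`n = 1` kernels (trapezoid, midpoint) and the mean-value step for weights `w ≥ 0`.  This file is self-contained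
(Mathlib only).

**Engine use.** Simpson panels are the default fixed rule of the engines' certified-quadrature clients when four
derivative bounds are available: `ζ (b - a)⁵/(2880 n⁴)` is the a-priori panel count for a requested tolerance,
the sign conditions give certified ONE-SIDED enclosures from function values alone, and `S_n = (4T_{2n} - T_n)/3`
lets a client reuse trapezoidal sums already computed (first Romberg column).  Honest framing: shared numerical
engines serving client cells; rigour lives in the verifiers; every published number belongs to a client cell's
ledger, not to the engines group.

References: [DavisRabinowitz1984] P. J. Davis, P. Rabinowitz, *Methods of Numerical Integration*, 2nd ed.,
Academic Press 1984, Sect. 2.2 (pp. 57–58, (2.2.1)–(2.2.6)), Sect. 4.3 (pp. 285–288, (4.3.11)–(4.3.14),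
(4.3.19)–(4.3.20)), Sect. 6.3 (p. 434, (6.3.3)).
-/

namespace Literature.Analysis.Quadrature

open Set MeasureTheory intervalIntegral Finset
open scoped Real Interval

noncomputable section

/-! ### The mean-value theorem for integrals with a non-positive weight -/

/-- **Mean-value theorem for integrals, non-positive weight** (the step (4.3.13) of the second Corollary of
Peano's theorem, in the sign needed for Simpson's kernel): for `a ≤ b`, `g` continuous on `[a, b]`, `w ≤ 0` on
`[a, b]` with `w` and `w · g` interval integrable, there is `ξ ∈ [a, b]` with `∫_a^b w g = g(ξ) ∫_a^b w`.
(The companion statement for `w ≥ 0` is `exists_integral_mul_eq_mul_integral` of the sibling file.)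
[cite: DavisRabinowitz1984, Sect. 4.3 (4.3.13)] -/
theorem exists_integral_mul_eq_mul_integral_of_nonpos {w g : ℝ → ℝ} {a b : ℝ} (hab : a ≤ b)
    (hg : ContinuousOn g (Icc a b)) (hw : ∀ x ∈ Icc a b, w x ≤ 0) (hwi : IntervalIntegrable w volume a b)
    (hwgi : IntervalIntegrable (fun x => w x * g x) volume a b) :
    ∃ ξ ∈ Icc a b, ∫ x in a..b, w x * g x = g ξ * ∫ x in a..b, w x := by
  have hne : (Icc a b).Nonempty := nonempty_Icc.mpr hab
  obtain ⟨x₁, hx₁, hmin⟩ := isCompact_Icc.exists_isMinOn hne hg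
  obtain ⟨x₂, hx₂, hmax⟩ := isCompact_Icc.exists_isMaxOn hne hg
  -- with `w ≤ 0` the inequalities of the non-negative case are reversed
  have hlo : g x₂ * ∫ x in a..b, w x ≤ ∫ x in a..b, w x * g x := by
    rw [← intervalIntegral.integral_const_mul]
    refine intervalIntegral.integral_mono_on hab (hwi.const_mul _) hwgi fun x hx => ?_
    rw [mul_comm]
    exact mul_le_mul_of_nonpos_left (hmax hx) (hw x hx)
  have hhi : ∫ x in a..b, w x * g x ≤ g x₁ * ∫ x in a..b, w x := by
    rw [← intervalIntegral.integral_const_mul]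
    refine intervalIntegral.integral_mono_on hab hwgi (hwi.const_mul _) fun x hx => ?_
    rw [mul_comm (g x₁)]
    exact mul_le_mul_of_nonpos_left (hmin hx) (hw x hx)
  have hW : ∫ x in a..b, w x ≤ 0 := by
    have h := intervalIntegral.integral_nonneg (μ := volume) hab fun x hx => neg_nonneg.2 (hw x hx)
    rw [intervalIntegral.integral_neg] at h
    linarith
  rcases hW.eq_or_lt with hW0 | hWneg
  · refine ⟨x₁, hx₁, ?_⟩
    rw [hW0, mul_zero] at hlo hhi ⊢
    exact le_antisymm hhi hlo
  · -- the ratio lies between the extreme values of `g`; intermediate value theorem on `[[x₁, x₂]] ⊆ [a, b]`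
    set r := (∫ x in a..b, w x * g x) / ∫ x in a..b, w x with hr
    have hr1 : g x₁ ≤ r := by rw [hr, le_div_iff_of_neg hWneg]; exact hhi
    have hr2 : r ≤ g x₂ := by rw [hr, div_le_iff_of_neg hWneg]; exact hlo
    have hsub : [[x₁, x₂]] ⊆ Icc a b := uIcc_subset_Icc hx₁ hx₂
    have hivt := intermediate_value_uIcc (hg.mono hsub)
    obtain ⟨ξ, hξ, hgξ⟩ := hivt (show r ∈ [[g x₁, g x₂]] from by
      rw [uIcc_of_le (hr1.trans hr2)]; exact ⟨hr1, hr2⟩)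
    refine ⟨ξ, hsub hξ, ?_⟩
    rw [hgξ, hr, div_mul_cancel₀ _ hWneg.ne]

/-! ### Simpson's functional and its Peano kernel (4.3.19) -/

/-- SIMPSON'S RULE on one panel `[a, b]` (Davis–Rabinowitz (2.2.2)):
`S(f) = (b - a)/6 · [f(a) + 4 f((a + b)/2) + f(b)]`. [cite: DavisRabinowitz1984, Sect. 2.2 (2.2.2)] -/
def simpson (f : ℝ → ℝ) (a b : ℝ) : ℝ := (b - a) / 6 * (f a + 4 * f ((a + b) / 2) + f b)

/-- The PEANO KERNEL of Simpson's rule (Davis–Rabinowitz (4.3.19), `K(t) = (1/6) E_x[(x - t)₊³]` computed out):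
with `u = min(t - a, b - t)`, `K(t) = u³ (3u - 2(b - a))/72`; i.e. `(t - a)³(3(t - a) - 2(b - a))/72` left of the
midpoint and the mirror image right of it. [cite: DavisRabinowitz1984, Sect. 4.3 (4.3.19)] -/
def simpsonKernel (a b t : ℝ) : ℝ :=
  min (t - a) (b - t) ^ 3 * (3 * min (t - a) (b - t) - 2 * (b - a)) / 72

/-- Left of the midpoint the kernel is `(t - a)³ (3(t - a) - 2(b - a))/72`.
[cite: DavisRabinowitz1984, Sect. 4.3 (4.3.19)] -/
theorem simpsonKernel_of_le {a b t : ℝ} (ht : t ≤ (a + b) / 2) :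
    simpsonKernel a b t = (t - a) ^ 3 * (3 * (t - a) - 2 * (b - a)) / 72 := by
  have h : min (t - a) (b - t) = t - a := min_eq_left (by linarith)
  simp only [simpsonKernel, h]

/-- Right of the midpoint the kernel is `(b - t)³ (3(b - t) - 2(b - a))/72`.
[cite: DavisRabinowitz1984, Sect. 4.3 (4.3.19)] -/
theorem simpsonKernel_of_ge {a b t : ℝ} (ht : (a + b) / 2 ≤ t) :
    simpsonKernel a b t = (b - t) ^ 3 * (3 * (b - t) - 2 * (b - a)) / 72 := by
  have h : min (t - a) (b - t) = b - t := min_eq_right (by linarith)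
  simp only [simpsonKernel, h]

/-- The kernel is symmetric about the midpoint: `K(a + b - t) = K(t)` (the book's `K(-t) = K(t)` on `[-1, 1]`).
[cite: DavisRabinowitz1984, Sect. 4.3 (4.3.19)] -/
theorem simpsonKernel_symm (a b t : ℝ) : simpsonKernel a b (a + b - t) = simpsonKernel a b t := by
  simp only [simpsonKernel]
  rw [show a + b - t - a = b - t by ring, show b - (a + b - t) = t - a by ring, min_comm]

/-- On `[-1, 1]` the kernel is the book's (4.3.19): `K(t) = -(1 - t)³(3t + 1)/72` for `0 ≤ t ≤ 1`.
[cite: DavisRabinowitz1984, Sect. 4.3 (4.3.19)] -/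
theorem simpsonKernel_neg_one_one {t : ℝ} (ht : 0 ≤ t) :
    simpsonKernel (-1) 1 t = -(1 - t) ^ 3 * (3 * t + 1) / 72 := by
  rw [simpsonKernel_of_ge (by linarith)]
  ring

/-- `K ≤ 0` on `[a, b]` ("the kernel is nonpositive, so that the second corollary is applicable").
[cite: DavisRabinowitz1984, Sect. 4.3 (4.3.19)] -/
theorem simpsonKernel_nonpos {a b t : ℝ} (ht : t ∈ Icc a b) : simpsonKernel a b t ≤ 0 := by
  unfold simpsonKernel
  have h0 : 0 ≤ min (t - a) (b - t) := le_min (by linarith [ht.1]) (by linarith [ht.2])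
  have h1 : 3 * min (t - a) (b - t) - 2 * (b - a) ≤ 0 := by
    linarith [min_le_left (t - a) (b - t), min_le_right (t - a) (b - t), ht.1, ht.2]
  have h2 := mul_nonpos_of_nonneg_of_nonpos (pow_nonneg h0 3) h1
  linarith

/-- The kernel is continuous. [cite: DavisRabinowitz1984, Sect. 4.3 (4.3.19)] -/
theorem continuous_simpsonKernel (a b : ℝ) : Continuous (simpsonKernel a b) := by
  have hu : Continuous fun t : ℝ => min (t - a) (b - t) := by fun_prop
  unfold simpsonKernel
  fun_prop

/-! ### Peano's theorem for Simpson's rule: `E(f) = ∫ K f⁽⁴⁾` -/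

/-- [folklore] Derivative bookkeeping for the quartic pieces of the kernel (`e` the base point, `c` a constant). -/
private theorem hasDerivAt_piece4 (e c x : ℝ) :
    HasDerivAt (fun x => (x - e) ^ 4 / 24 + c * (x - e) ^ 3 / 18) ((x - e) ^ 3 / 6 + c * (x - e) ^ 2 / 6) x := by
  have h : HasDerivAt (fun x => x - e) 1 x := (hasDerivAt_id x).sub_const e
  exact (((h.pow 4).div_const 24).add (((h.pow 3).const_mul c).div_const 18)).congr_deriv (by norm_num; ring)

/-- [folklore] Derivative bookkeeping, cubic piece. -/
private theorem hasDerivAt_piece3 (e c x : ℝ) :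
    HasDerivAt (fun x => (x - e) ^ 3 / 6 + c * (x - e) ^ 2 / 6) ((x - e) ^ 2 / 2 + c * (x - e) / 3) x := by
  have h : HasDerivAt (fun x => x - e) 1 x := (hasDerivAt_id x).sub_const e
  exact (((h.pow 3).div_const 6).add (((h.pow 2).const_mul c).div_const 6)).congr_deriv (by norm_num; ring)

/-- [folklore] Derivative bookkeeping, quadratic piece. -/
private theorem hasDerivAt_piece2 (e c x : ℝ) :
    HasDerivAt (fun x => (x - e) ^ 2 / 2 + c * (x - e) / 3) ((x - e) + c / 3) x := by
  have h : HasDerivAt (fun x => x - e) 1 x := (hasDerivAt_id x).sub_const e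
  exact (((h.pow 2).div_const 2).add ((h.const_mul c).div_const 3)).congr_deriv (by norm_num)

/-- [folklore] Derivative bookkeeping, linear piece. -/
private theorem hasDerivAt_piece1 (e c x : ℝ) : HasDerivAt (fun x => (x - e) + c / 3) 1 x :=
  ((hasDerivAt_id x).sub_const e).add_const _

/-- **Peano kernel identity for Simpson's rule** (Peano's theorem (4.3.5)–(4.3.6) with `n = 3` for the functional
`E(f) = ∫_a^b f - S(f)`, kernel (4.3.19)): for `a ≤ b` and `f` with a chain of derivatives `f₁, f₂, f₃, f₄` on
`[a, b]`, `f₄` interval integrable, `∫_a^b f - S(f) = ∫_a^b K(t) f₄(t) dt`.  Four integrations by parts on each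
half-panel; the boundary terms in `f₃((a+b)/2)`, `f₂`, `f₁((a+b)/2)` cancel and the `f`-terms assemble `S(f)`.
[cite: DavisRabinowitz1984, Sect. 4.3 (4.3.19)] [cite: DavisRabinowitz1984, Sect. 4.3 (4.3.5)] -/
theorem integral_sub_simpson_eq_integral_kernel {f f₁ f₂ f₃ f₄ : ℝ → ℝ} {a b : ℝ} (hab : a ≤ b)
    (hf : ∀ x ∈ Icc a b, HasDerivAt f (f₁ x) x) (hf₁ : ∀ x ∈ Icc a b, HasDerivAt f₁ (f₂ x) x)
    (hf₂ : ∀ x ∈ Icc a b, HasDerivAt f₂ (f₃ x) x) (hf₃ : ∀ x ∈ Icc a b, HasDerivAt f₃ (f₄ x) x)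
    (hf₄ : IntervalIntegrable f₄ volume a b) :
    (∫ x in a..b, f x) - simpson f a b = ∫ x in a..b, simpsonKernel a b x * f₄ x := by
  set m : ℝ := (a + b) / 2 with hm
  set c : ℝ := (b - a) / 2 with hc
  have ham : a ≤ m := by rw [hm]; linarith
  have hmb : m ≤ b := by rw [hm]; linarith
  have hIab : [[a, b]] = Icc a b := uIcc_of_le hab
  have hIam : [[a, m]] ⊆ Icc a b := by rw [uIcc_of_le ham]; exact Icc_subset_Icc_right hmb
  have hImb : [[m, b]] ⊆ Icc a b := by rw [uIcc_of_le hmb]; exact Icc_subset_Icc_left ham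
  have hIam' : [[a, m]] ⊆ [[a, b]] := by rw [hIab]; exact hIam
  have hImb' : [[m, b]] ⊆ [[a, b]] := by rw [hIab]; exact hImb
  have hf₄am : IntervalIntegrable f₄ volume a m := hf₄.mono_set hIam'
  have hf₄mb : IntervalIntegrable f₄ volume m b := hf₄.mono_set hImb'
  have hfc : ContinuousOn f (Icc a b) := fun x hx => (hf x hx).continuousAt.continuousWithinAt
  have hf₁c : ContinuousOn f₁ (Icc a b) := fun x hx => (hf₁ x hx).continuousAt.continuousWithinAt
  have hf₂c : ContinuousOn f₂ (Icc a b) := fun x hx => (hf₂ x hx).continuousAt.continuousWithinAt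
  have hf₃c : ContinuousOn f₃ (Icc a b) := fun x hx => (hf₃ x hx).continuousAt.continuousWithinAt
  -- left half-panel `[a, m]`: `u = (x - a)⁴/24 - c (x - a)³/18` and its three derivatives
  have hL1 := intervalIntegral.integral_mul_deriv_eq_deriv_mul (a := a) (b := m)
    (u := fun x => (x - a) ^ 4 / 24 + (-c) * (x - a) ^ 3 / 18)
    (u' := fun x => (x - a) ^ 3 / 6 + (-c) * (x - a) ^ 2 / 6) (v := f₃) (v' := f₄)
    (fun x _ => hasDerivAt_piece4 a (-c) x) (fun x hx => hf₃ x (hIam hx))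
    (Continuous.intervalIntegrable (by fun_prop) _ _) hf₄am
  have hL2 := intervalIntegral.integral_mul_deriv_eq_deriv_mul (a := a) (b := m)
    (u := fun x => (x - a) ^ 3 / 6 + (-c) * (x - a) ^ 2 / 6)
    (u' := fun x => (x - a) ^ 2 / 2 + (-c) * (x - a) / 3) (v := f₂) (v' := f₃)
    (fun x _ => hasDerivAt_piece3 a (-c) x) (fun x hx => hf₂ x (hIam hx))
    (Continuous.intervalIntegrable (by fun_prop) _ _) (hf₃c.mono hIam).intervalIntegrable
  have hL3 := intervalIntegral.integral_mul_deriv_eq_deriv_mul (a := a) (b := m)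
    (u := fun x => (x - a) ^ 2 / 2 + (-c) * (x - a) / 3)
    (u' := fun x => (x - a) + (-c) / 3) (v := f₁) (v' := f₂)
    (fun x _ => hasDerivAt_piece2 a (-c) x) (fun x hx => hf₁ x (hIam hx))
    (Continuous.intervalIntegrable (by fun_prop) _ _) (hf₂c.mono hIam).intervalIntegrable
  have hL4 := intervalIntegral.integral_mul_deriv_eq_deriv_mul (a := a) (b := m)
    (u := fun x => (x - a) + (-c) / 3) (u' := fun _ => (1 : ℝ)) (v := f) (v' := f₁)
    (fun x _ => hasDerivAt_piece1 a (-c) x) (fun x hx => hf x (hIam hx))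
    intervalIntegrable_const (hf₁c.mono hIam).intervalIntegrable
  -- right half-panel `[m, b]`: `u = (x - b)⁴/24 + c (x - b)³/18` and its three derivatives
  have hR1 := intervalIntegral.integral_mul_deriv_eq_deriv_mul (a := m) (b := b)
    (u := fun x => (x - b) ^ 4 / 24 + c * (x - b) ^ 3 / 18)
    (u' := fun x => (x - b) ^ 3 / 6 + c * (x - b) ^ 2 / 6) (v := f₃) (v' := f₄)
    (fun x _ => hasDerivAt_piece4 b c x) (fun x hx => hf₃ x (hImb hx))
    (Continuous.intervalIntegrable (by fun_prop) _ _) hf₄mb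
  have hR2 := intervalIntegral.integral_mul_deriv_eq_deriv_mul (a := m) (b := b)
    (u := fun x => (x - b) ^ 3 / 6 + c * (x - b) ^ 2 / 6)
    (u' := fun x => (x - b) ^ 2 / 2 + c * (x - b) / 3) (v := f₂) (v' := f₃)
    (fun x _ => hasDerivAt_piece3 b c x) (fun x hx => hf₂ x (hImb hx))
    (Continuous.intervalIntegrable (by fun_prop) _ _) (hf₃c.mono hImb).intervalIntegrable
  have hR3 := intervalIntegral.integral_mul_deriv_eq_deriv_mul (a := m) (b := b)
    (u := fun x => (x - b) ^ 2 / 2 + c * (x - b) / 3)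
    (u' := fun x => (x - b) + c / 3) (v := f₁) (v' := f₂)
    (fun x _ => hasDerivAt_piece2 b c x) (fun x hx => hf₁ x (hImb hx))
    (Continuous.intervalIntegrable (by fun_prop) _ _) (hf₂c.mono hImb).intervalIntegrable
  have hR4 := intervalIntegral.integral_mul_deriv_eq_deriv_mul (a := m) (b := b)
    (u := fun x => (x - b) + c / 3) (u' := fun _ => (1 : ℝ)) (v := f) (v' := f₁)
    (fun x _ => hasDerivAt_piece1 b c x) (fun x hx => hf x (hImb hx))
    intervalIntegrable_const (hf₁c.mono hImb).intervalIntegrable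
  -- split `∫ f` and `∫ K f₄` at the midpoint
  have hfi : IntervalIntegrable f volume a b := (hfc.mono hIab.le).intervalIntegrable
  have hsplitf : ∫ x in a..b, f x = (∫ x in a..m, f x) + ∫ x in m..b, f x :=
    (intervalIntegral.integral_add_adjacent_intervals (hfi.mono_set hIam') (hfi.mono_set hImb')).symm
  have hKi : IntervalIntegrable (fun x => simpsonKernel a b x * f₄ x) volume a b :=
    hf₄.continuousOn_mul (continuous_simpsonKernel a b).continuousOn
  have hsplitK : ∫ x in a..b, simpsonKernel a b x * f₄ x =
      (∫ x in a..m, ((x - a) ^ 4 / 24 + (-c) * (x - a) ^ 3 / 18) * f₄ x) +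
        ∫ x in m..b, ((x - b) ^ 4 / 24 + c * (x - b) ^ 3 / 18) * f₄ x := by
    rw [← intervalIntegral.integral_add_adjacent_intervals (hKi.mono_set hIam') (hKi.mono_set hImb')]
    congr 1
    · refine intervalIntegral.integral_congr fun x hx => ?_
      rw [uIcc_of_le ham] at hx
      simp only [simpsonKernel_of_le hx.2]
      rw [hc]
      ring
    · refine intervalIntegral.integral_congr fun x hx => ?_
      rw [uIcc_of_le hmb] at hx
      simp only [simpsonKernel_of_ge hx.1]
      rw [hc]
      ring
  rw [hsplitK, hL1, hL2, hL3, hL4, hR1, hR2, hR3, hR4, hsplitf]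
  simp only [simpson, one_mul]
  rw [hm, hc]
  ring

/-- `∫_a^b K = -(b - a)⁵/2880` (the case `f = x⁴/4!` of the kernel identity; equivalently
`E(x⁴) = 4! ∫ K = -(b - a)⁵/120`, (4.3.14), on `[-1, 1]`: `E(x⁴) = -4/15`).
[cite: DavisRabinowitz1984, Sect. 4.3 (4.3.14)] [cite: DavisRabinowitz1984, Sect. 2.2 (2.2.1)] -/
theorem integral_simpsonKernel {a b : ℝ} (hab : a ≤ b) :
    ∫ x in a..b, simpsonKernel a b x = -(b - a) ^ 5 / 2880 := by
  have h := integral_sub_simpson_eq_integral_kernel hab (f := fun x => x ^ 4 / 24) (f₁ := fun x => x ^ 3 / 6)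
    (f₂ := fun x => x ^ 2 / 2) (f₃ := fun x => x) (f₄ := fun _ => 1)
    (fun x _ => ((hasDerivAt_id' x).pow 4 |>.div_const 24).congr_deriv (by norm_num; ring))
    (fun x _ => ((hasDerivAt_id' x).pow 3 |>.div_const 6).congr_deriv (by norm_num; ring))
    (fun x _ => ((hasDerivAt_id' x).pow 2 |>.div_const 2).congr_deriv (by norm_num))
    (fun x _ => hasDerivAt_id' x) intervalIntegrable_const
  simp only [mul_one] at h
  rw [← h, intervalIntegral.integral_div, integral_pow, simpson]
  ring

/-- **Simpson's rule with its error term** (Davis–Rabinowitz (2.2.1); (4.3.20) on `[-1, 1]`): for `a ≤ b` and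
`f ∈ C⁴[a, b]` (a chain of derivatives `f₁, …, f₄` on `[a, b]`, `f₄` continuous) there is `ξ ∈ [a, b]` with
`∫_a^b f = (b - a)/6 [f a + 4 f((a+b)/2) + f b] - (b - a)⁵/2880 · f⁽⁴⁾(ξ)`.
[cite: DavisRabinowitz1984, Sect. 2.2 (2.2.1)] [cite: DavisRabinowitz1984, Sect. 4.3 (4.3.20)] -/
theorem integral_eq_simpson_sub_deriv4 {f f₁ f₂ f₃ f₄ : ℝ → ℝ} {a b : ℝ} (hab : a ≤ b)
    (hf : ∀ x ∈ Icc a b, HasDerivAt f (f₁ x) x) (hf₁ : ∀ x ∈ Icc a b, HasDerivAt f₁ (f₂ x) x)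
    (hf₂ : ∀ x ∈ Icc a b, HasDerivAt f₂ (f₃ x) x) (hf₃ : ∀ x ∈ Icc a b, HasDerivAt f₃ (f₄ x) x)
    (hf₄ : ContinuousOn f₄ (Icc a b)) :
    ∃ ξ ∈ Icc a b, ∫ x in a..b, f x = simpson f a b - (b - a) ^ 5 / 2880 * f₄ ξ := by
  have hI : [[a, b]] = Icc a b := uIcc_of_le hab
  have hf₄u : ContinuousOn f₄ [[a, b]] := by rwa [hI]
  have hker := integral_sub_simpson_eq_integral_kernel hab hf hf₁ hf₂ hf₃ hf₄u.intervalIntegrable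
  have hKc := continuous_simpsonKernel a b
  obtain ⟨ξ, hξ, hmvt⟩ := exists_integral_mul_eq_mul_integral_of_nonpos hab hf₄
    (fun x hx => simpsonKernel_nonpos hx) (hKc.intervalIntegrable _ _)
    ((hKc.continuousOn.mul hf₄u).intervalIntegrable)
  refine ⟨ξ, hξ, ?_⟩
  rw [hmvt, integral_simpsonKernel hab] at hker
  linarith

/-- **Error bound for Simpson's rule** ((4.3.11) for Simpson's functional): if `|f⁽⁴⁾| ≤ ζ` on `[a, b]` then
`|∫_a^b f - S(f)| ≤ ζ (b - a)⁵/2880`. [cite: DavisRabinowitz1984, Sect. 4.3 (4.3.11)]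
[cite: DavisRabinowitz1984, Sect. 2.2 (2.2.1)] -/
theorem abs_integral_sub_simpson_le {f f₁ f₂ f₃ f₄ : ℝ → ℝ} {a b : ℝ} (hab : a ≤ b)
    (hf : ∀ x ∈ Icc a b, HasDerivAt f (f₁ x) x) (hf₁ : ∀ x ∈ Icc a b, HasDerivAt f₁ (f₂ x) x)
    (hf₂ : ∀ x ∈ Icc a b, HasDerivAt f₂ (f₃ x) x) (hf₃ : ∀ x ∈ Icc a b, HasDerivAt f₃ (f₄ x) x)
    (hf₄ : IntervalIntegrable f₄ volume a b) {ζ : ℝ} (hζ : ∀ x ∈ Icc a b, |f₄ x| ≤ ζ) :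
    |(∫ x in a..b, f x) - simpson f a b| ≤ ζ * (b - a) ^ 5 / 2880 := by
  rw [integral_sub_simpson_eq_integral_kernel hab hf hf₁ hf₂ hf₃ hf₄]
  have hKc := continuous_simpsonKernel a b
  have hKi : IntervalIntegrable (fun x => simpsonKernel a b x * f₄ x) volume a b :=
    hf₄.continuousOn_mul hKc.continuousOn
  have hKζ : IntervalIntegrable (fun x => ζ * simpsonKernel a b x) volume a b :=
    (hKc.intervalIntegrable _ _).const_mul ζ
  -- `K ≤ 0`, so `ζ K ≤ K f₄ ≤ -ζ K`
  have hup : ∫ x in a..b, simpsonKernel a b x * f₄ x ≤ ∫ x in a..b, -(ζ * simpsonKernel a b x) := by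
    refine intervalIntegral.integral_mono_on hab hKi hKζ.neg fun x hx => ?_
    have := mul_le_mul_of_nonpos_left (neg_le_of_abs_le (hζ x hx)) (simpsonKernel_nonpos hx)
    linarith
  have hlo : ∫ x in a..b, ζ * simpsonKernel a b x ≤ ∫ x in a..b, simpsonKernel a b x * f₄ x := by
    refine intervalIntegral.integral_mono_on hab hKζ hKi fun x hx => ?_
    have := mul_le_mul_of_nonpos_left (le_of_abs_le (hζ x hx)) (simpsonKernel_nonpos hx)
    linarith
  rw [intervalIntegral.integral_neg] at hup
  rw [intervalIntegral.integral_const_mul, integral_simpsonKernel hab] at hup hlo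
  rw [abs_le]
  constructor <;> linarith

/-- **Simpson's rule is exact for cubics** ((2.2.2): "exact for all polynomials of degree three or less").
[cite: DavisRabinowitz1984, Sect. 2.2 (2.2.2)] -/
theorem integral_cubic_eq_simpson (c₀ c₁ c₂ c₃ a b : ℝ) :
    ∫ x in a..b, (c₀ + c₁ * x + c₂ * x ^ 2 + c₃ * x ^ 3) =
      simpson (fun x => c₀ + c₁ * x + c₂ * x ^ 2 + c₃ * x ^ 3) a b := by
  have hP : ∀ x, HasDerivAt (fun x => c₀ * x + c₁ * x ^ 2 / 2 + c₂ * x ^ 3 / 3 + c₃ * x ^ 4 / 4)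
      (c₀ + c₁ * x + c₂ * x ^ 2 + c₃ * x ^ 3) x := by
    intro x
    have h := hasDerivAt_id' x
    exact ((((h.const_mul c₀).add (((h.pow 2).const_mul c₁).div_const 2)).add
      (((h.pow 3).const_mul c₂).div_const 3)).add (((h.pow 4).const_mul c₃).div_const 4)).congr_deriv
        (by norm_num; ring)
  rw [intervalIntegral.integral_eq_sub_of_hasDerivAt (fun x _ => hP x)
    (Continuous.intervalIntegrable (by fun_prop) _ _)]
  simp only [simpson]
  ring

/-! ### The compound Simpson rule (2.2.4), its error term (2.2.5)–(2.2.6), the Romberg relation, enclosures -/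

/-- The COMPOUND SIMPSON RULE over `n` panels `[a + kH, a + (k + 1)H]`, `H = (b - a)/n`:
`S_n(f) = Σ_{k<n} H/6 · [f(a + kH) + 4 f(a + (k + ½)H) + f(a + (k + 1)H)]` — the book's (2.2.4) with `N = 2n`
subintervals of length `h = H/2` (`simpsonRule_eq_sum_weights`). [cite: DavisRabinowitz1984, Sect. 2.2 (2.2.4)] -/
def simpsonRule (f : ℝ → ℝ) (n : ℕ) (a b : ℝ) : ℝ :=
  ∑ k ∈ range n, (b - a) / n / 6 *
    (f (a + k * ((b - a) / n)) + 4 * f (a + (k + 2⁻¹) * ((b - a) / n)) + f (a + (k + 1) * ((b - a) / n)))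

/-- One panel: `S_1(f) = S(f)`. [cite: DavisRabinowitz1984, Sect. 2.2 (2.2.2)] -/
theorem simpsonRule_one (f : ℝ → ℝ) (a b : ℝ) : simpsonRule f 1 a b = simpson f a b := by
  simp only [simpsonRule, simpson, sum_range_one, Nat.cast_one, div_one, Nat.cast_zero, zero_mul, add_zero,
    zero_add, one_mul]
  rw [show a + 2⁻¹ * (b - a) = (a + b) / 2 by ring, show a + (b - a) = b by ring]

/-- `S_n` is the sum of the one-panel rules over the panels `[a + kH, a + (k + 1)H]` (compounding, Sect. 2.4
(2.4.1); the Simpson analogue of Mathlib's `sum_trapezoidal_integral_adjacent_intervals`).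
[cite: DavisRabinowitz1984, Sect. 2.2 (2.2.4)] [cite: DavisRabinowitz1984, Sect. 2.4 (2.4.1)] -/
theorem sum_simpson_eq_simpsonRule (f : ℝ → ℝ) (n : ℕ) (a H : ℝ) :
    ∑ k ∈ range n, simpson f (a + k * H) (a + (k + 1) * H) = simpsonRule f n a (a + n * H) := by
  rcases Nat.eq_zero_or_pos n with rfl | hn
  · simp [simpsonRule]
  · have hn' : (n : ℝ) ≠ 0 := by exact_mod_cast hn.ne'
    unfold simpsonRule simpson
    rw [show (a + n * H - a) / n = H by field_simp; ring]
    refine sum_congr rfl fun k _ => ?_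
    rw [show a + (k + 1) * H - (a + k * H) = H by ring,
      show (a + k * H + (a + (k + 1) * H)) / 2 = a + (k + 2⁻¹) * H by ring]

/-- **The book's form (2.2.4)**: with `N = 2n` subintervals of length `h = (b - a)/(2n)` and `f_i = f(a + ih)`,
`S_n(f) = h/3 · [f_0 + 4(f_1 + f_3 + ⋯ + f_{2n-1}) + 2(f_2 + f_4 + ⋯ + f_{2n-2}) + f_{2n}]`.
[cite: DavisRabinowitz1984, Sect. 2.2 (2.2.4)] -/
theorem simpsonRule_eq_sum_weights (f : ℝ → ℝ) {n : ℕ} (hn : 0 < n) (a b : ℝ) :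
    simpsonRule f n a b = (b - a) / (2 * n) / 3 *
      (f a + 4 * ∑ i ∈ range n, f (a + (2 * i + 1) * ((b - a) / (2 * n)))
        + 2 * ∑ i ∈ range (n - 1), f (a + (2 * i + 2) * ((b - a) / (2 * n))) + f b) := by
  obtain ⟨p, rfl⟩ : ∃ p, n = p + 1 := ⟨n - 1, by omega⟩
  have hp' : ((p + 1 : ℕ) : ℝ) ≠ 0 := by positivity
  set η : ℝ := (b - a) / (2 * ((p + 1 : ℕ) : ℝ)) with hη
  have hH : (b - a) / ((p + 1 : ℕ) : ℝ) = 2 * η := by rw [hη]; ring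
  have hb : a + (2 * p + 2) * η = b := by
    rw [hη]; push_cast; field_simp; ring
  unfold simpsonRule
  simp only [Nat.add_sub_cancel]
  rw [hH]
  have hsummand : ∀ k : ℕ, 2 * η / 6 * (f (a + k * (2 * η)) + 4 * f (a + (k + 2⁻¹) * (2 * η))
      + f (a + (k + 1) * (2 * η))) = η / 3 * f (a + 2 * k * η) + (4 * (η / 3) * f (a + (2 * k + 1) * η)
      + η / 3 * f (a + (2 * k + 2) * η)) := by
    intro k
    rw [show a + k * (2 * η) = a + 2 * k * η by ring, show a + (k + 2⁻¹) * (2 * η) = a + (2 * k + 1) * η by ring,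
      show a + (k + 1) * (2 * η) = a + (2 * k + 2) * η by ring]
    ring
  simp_rw [hsummand]
  rw [sum_add_distrib, sum_add_distrib, ← mul_sum, ← mul_sum, ← mul_sum,
    sum_range_succ' (fun k : ℕ => f (a + 2 * (k : ℝ) * η)), sum_range_succ (fun k : ℕ => f (a + (2 * (k : ℝ) + 2) * η))]
  have hmid : ∑ k ∈ range p, f (a + 2 * ((k + 1 : ℕ) : ℝ) * η) = ∑ k ∈ range p, f (a + (2 * k + 2) * η) :=
    sum_congr rfl fun k _ => by push_cast; ring_nf
  rw [hmid, hb, Nat.cast_zero, mul_zero, zero_mul, add_zero]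
  ring

/-- [folklore] Regrouping a sum over `2n` indices in consecutive pairs. -/
private theorem sum_range_two_mul (g : ℕ → ℝ) (n : ℕ) :
    ∑ j ∈ range (2 * n), g j = ∑ k ∈ range n, (g (2 * k) + g (2 * k + 1)) := by
  induction n with
  | zero => simp
  | succ n ih =>
    rw [show 2 * (n + 1) = 2 * n + 1 + 1 by ring, sum_range_succ, sum_range_succ, ih, sum_range_succ]
    ring

/-- **Simpson from two trapezoidal sums** (the first Romberg column: Davis–Rabinowitz Sect. 6.3 (6.3.3) with
`m = 1`, "the values `T₁⁽ᵏ⁾` turn out to be exactly those obtained by use of Simpson's rule"):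
`S_n(f) = (4 T_{2n}(f) - T_n(f))/3` for Mathlib's compound trapezoidal rule `trapezoidal_integral`.
[cite: DavisRabinowitz1984, Sect. 6.3 (6.3.3)] -/
theorem simpsonRule_eq_trapezoidal (f : ℝ → ℝ) (n : ℕ) (a b : ℝ) :
    simpsonRule f n a b = (4 * trapezoidal_integral f (2 * n) a b - trapezoidal_integral f n a b) / 3 := by
  rcases Nat.eq_zero_or_pos n with rfl | hn
  · simp [simpsonRule, trapezoidal_integral]
  have hn' : (n : ℝ) ≠ 0 := by exact_mod_cast hn.ne'
  have h2n : 0 < 2 * n := by omega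
  set H : ℝ := (b - a) / n with hH
  have hb : a + n * H = b := by rw [hH]; field_simp; ring
  have hb2 : a + ((2 * n : ℕ) : ℝ) * (H / 2) = b := by rw [← hb]; push_cast; ring
  have hS : simpsonRule f n a b = ∑ k ∈ range n, simpson f (a + k * H) (a + (k + 1) * H) := by
    rw [sum_simpson_eq_simpsonRule, hb]
  have hT1 : trapezoidal_integral f n a b = ∑ k ∈ range n, trapezoidal_integral f 1 (a + k * H) (a + (k + 1) * H) := by
    rw [sum_trapezoidal_integral_adjacent_intervals hn, hb]
  have hT2 : trapezoidal_integral f (2 * n) a b =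
      ∑ j ∈ range (2 * n), trapezoidal_integral f 1 (a + j * (H / 2)) (a + (j + 1) * (H / 2)) := by
    rw [sum_trapezoidal_integral_adjacent_intervals h2n, hb2]
  rw [hS, hT1, hT2, sum_range_two_mul, mul_sum, ← sum_sub_distrib, Finset.sum_div]
  refine sum_congr rfl fun k _ => ?_
  simp only [simpson, trapezoidal_integral_one]
  push_cast
  rw [show a + 2 * (k : ℝ) * (H / 2) = a + k * H by ring,
    show a + (2 * (k : ℝ) + 1) * (H / 2) = a + (k + 2⁻¹) * H by ring,
    show a + (2 * (k : ℝ) + 1 + 1) * (H / 2) = a + (k + 1) * H by ring,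
    show (a + k * H + (a + (k + 1) * H)) / 2 = a + (k + 2⁻¹) * H by ring]
  ring

/-- [folklore] Panel bookkeeping: for `a ≤ b`, `0 < n`, `H = (b - a)/n`, the panels are ordered and lie in
`[a, b]`. -/
private theorem panel_aux {a b : ℝ} (hab : a ≤ b) {n : ℕ} (hn : 0 < n) :
    a + n * ((b - a) / n) = b ∧ (∀ k : ℕ, a + k * ((b - a) / n) ≤ a + (k + 1) * ((b - a) / n)) ∧
      ∀ k < n, Icc (a + k * ((b - a) / n)) (a + (k + 1) * ((b - a) / n)) ⊆ Icc a b := by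
  have hn' : (0 : ℝ) < n := by exact_mod_cast hn
  set H : ℝ := (b - a) / n with hH
  have hH0 : 0 ≤ H := div_nonneg (sub_nonneg.2 hab) hn'.le
  have hb : a + n * H = b := by rw [hH]; field_simp; ring
  refine ⟨hb, fun k => by nlinarith, fun k hk => ?_⟩
  have hk' : (k : ℝ) + 1 ≤ n := by exact_mod_cast hk
  refine Icc_subset_Icc (by nlinarith [(k.cast_nonneg : (0 : ℝ) ≤ k)]) ?_
  rw [← hb]
  nlinarith

/-- [folklore] `∫_a^b f` and `S_n(f)` as sums over the panels. -/
private theorem integral_eq_sum_panels {f : ℝ → ℝ} {a b : ℝ} (hab : a ≤ b) {n : ℕ} (hn : 0 < n)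
    (hfi : IntervalIntegrable f volume a b) :
    ∫ t in a..b, f t = ∑ k ∈ range n, ∫ t in (a + k * ((b - a) / n))..(a + (k + 1) * ((b - a) / n)), f t := by
  obtain ⟨hb, hlohi, hsub⟩ := panel_aux hab hn
  have hsub' : ∀ k < n, [[a + k * ((b - a) / n), a + (k + 1) * ((b - a) / n)]] ⊆ [[a, b]] := fun k hk => by
    rw [uIcc_of_le (hlohi k), uIcc_of_le hab]; exact hsub k hk
  have hs := intervalIntegral.sum_integral_adjacent_intervals (a := fun k : ℕ => a + k * ((b - a) / n)) (n := n)
    (μ := volume) (f := f) fun k hk => by simpa using hfi.mono_set (hsub' k hk)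
  simpa [hb] using hs.symm

/-- [folklore] Discrete intermediate-value step from the one-panel error terms to (2.2.5): a sum of `n ≥ 1`
values of a continuous `g` at points of `[a, b]` equals `n · g(η)` for some `η ∈ [a, b]`. -/
private theorem exists_sum_eq_card_mul {g : ℝ → ℝ} {a b : ℝ} (hab : a ≤ b) (hg : ContinuousOn g (Icc a b))
    {n : ℕ} (hn : 0 < n) {ξ : ℕ → ℝ} (hξ : ∀ k < n, ξ k ∈ Icc a b) :
    ∃ η ∈ Icc a b, ∑ k ∈ range n, g (ξ k) = n * g η := by
  have hne : (Icc a b).Nonempty := nonempty_Icc.mpr hab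
  obtain ⟨x₁, hx₁, hmin⟩ := isCompact_Icc.exists_isMinOn hne hg
  obtain ⟨x₂, hx₂, hmax⟩ := isCompact_Icc.exists_isMaxOn hne hg
  have hn' : (0 : ℝ) < n := by exact_mod_cast hn
  have hlo : (n : ℝ) * g x₁ ≤ ∑ k ∈ range n, g (ξ k) := by
    have h := Finset.sum_le_sum (s := range n) fun k hk =>
      show g x₁ ≤ g (ξ k) from hmin (hξ k (mem_range.mp hk))
    simpa [sum_const, card_range] using h
  have hhi : ∑ k ∈ range n, g (ξ k) ≤ n * g x₂ := by
    have h := Finset.sum_le_sum (s := range n) fun k hk =>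
      show g (ξ k) ≤ g x₂ from hmax (hξ k (mem_range.mp hk))
    simpa [sum_const, card_range] using h
  set r := (∑ k ∈ range n, g (ξ k)) / n with hr
  have hr1 : g x₁ ≤ r := by rw [hr, le_div_iff₀ hn']; linarith
  have hr2 : r ≤ g x₂ := by rw [hr, div_le_iff₀ hn']; linarith
  have hsub : [[x₁, x₂]] ⊆ Icc a b := uIcc_subset_Icc hx₁ hx₂
  obtain ⟨η, hη, hgη⟩ := intermediate_value_uIcc (hg.mono hsub) (show r ∈ [[g x₁, g x₂]] from by
    rw [uIcc_of_le (hr1.trans hr2)]; exact ⟨hr1, hr2⟩)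
  refine ⟨η, hsub hη, ?_⟩
  rw [hgη, hr]
  field_simp

/-- **Error bound for the compound Simpson rule** (Davis–Rabinowitz (2.2.6), `N = 2n`): for `a ≤ b`, `0 < n`
and `|f⁽⁴⁾| ≤ ζ` on `[a, b]`, `|∫_a^b f - S_n(f)| ≤ ζ (b - a)⁵/(2880 n⁴) = ζ (b - a)⁵/(180 N⁴)`.
[cite: DavisRabinowitz1984, Sect. 2.2 (2.2.6)] -/
theorem abs_integral_sub_simpsonRule_le {f f₁ f₂ f₃ f₄ : ℝ → ℝ} {a b : ℝ} (hab : a ≤ b) {n : ℕ} (hn : 0 < n)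
    (hf : ∀ x ∈ Icc a b, HasDerivAt f (f₁ x) x) (hf₁ : ∀ x ∈ Icc a b, HasDerivAt f₁ (f₂ x) x)
    (hf₂ : ∀ x ∈ Icc a b, HasDerivAt f₂ (f₃ x) x) (hf₃ : ∀ x ∈ Icc a b, HasDerivAt f₃ (f₄ x) x)
    (hf₄ : IntervalIntegrable f₄ volume a b) {ζ : ℝ} (hζ : ∀ x ∈ Icc a b, |f₄ x| ≤ ζ) :
    |(∫ x in a..b, f x) - simpsonRule f n a b| ≤ ζ * (b - a) ^ 5 / (2880 * n ^ 4) := by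
  have hn' : (0 : ℝ) < n := by exact_mod_cast hn
  obtain ⟨hb, hlohi, hsub⟩ := panel_aux hab hn
  set H : ℝ := (b - a) / n with hH
  have hIab : [[a, b]] = Icc a b := uIcc_of_le hab
  have hsub' : ∀ k < n, [[a + k * H, a + (k + 1) * H]] ⊆ [[a, b]] := fun k hk => by
    rw [uIcc_of_le (hlohi k), hIab]; exact hsub k hk
  -- per-panel bound
  have hpanel : ∀ k ∈ range n, |(∫ t in (a + k * H)..(a + (k + 1) * H), f t)
      - simpson f (a + k * H) (a + (k + 1) * H)| ≤ ζ * H ^ 5 / 2880 := by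
    intro k hk
    rw [Finset.mem_range] at hk
    have hp := abs_integral_sub_simpson_le (hlohi k) (fun t ht => hf t (hsub k hk ht))
      (fun t ht => hf₁ t (hsub k hk ht)) (fun t ht => hf₂ t (hsub k hk ht)) (fun t ht => hf₃ t (hsub k hk ht))
      (hf₄.mono_set (hsub' k hk)) (fun t ht => hζ t (hsub k hk ht))
    rwa [show a + (k + 1) * H - (a + k * H) = H by ring] at hp
  have hfi : IntervalIntegrable f volume a b :=
    ContinuousOn.intervalIntegrable fun x hx => (hf x (hIab ▸ hx)).continuousAt.continuousWithinAt
  have hint := integral_eq_sum_panels hab hn hfi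
  have hS : simpsonRule f n a b = ∑ k ∈ range n, simpson f (a + k * H) (a + (k + 1) * H) := by
    rw [sum_simpson_eq_simpsonRule, hb]
  calc |(∫ x in a..b, f x) - simpsonRule f n a b|
      = |∑ k ∈ range n, ((∫ t in (a + k * H)..(a + (k + 1) * H), f t) - simpson f (a + k * H) (a + (k + 1) * H))| := by
        rw [hint, hS, sum_sub_distrib]
    _ ≤ ∑ k ∈ range n, |(∫ t in (a + k * H)..(a + (k + 1) * H), f t) - simpson f (a + k * H) (a + (k + 1) * H)| :=
        abs_sum_le_sum_abs _ _
    _ ≤ ∑ k ∈ range n, ζ * H ^ 5 / 2880 := sum_le_sum hpanel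
    _ = ζ * (b - a) ^ 5 / (2880 * n ^ 4) := by
        rw [sum_const, card_range, nsmul_eq_mul, hH]
        field_simp

/-- **The compound Simpson rule with its error term** (Davis–Rabinowitz (2.2.5) = (2.2.6): `E_n = -n h⁵/90 f⁽⁴⁾(ξ)
= -(b - a)⁵/(180 N⁴) f⁽⁴⁾(ξ)`, `h = (b - a)/(2n)`, `N = 2n`): for `a ≤ b`, `0 < n` and `f ∈ C⁴[a, b]` there is
`ξ ∈ [a, b]` with `∫_a^b f = S_n(f) - (b - a)⁵/(2880 n⁴) · f⁽⁴⁾(ξ)`.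
[cite: DavisRabinowitz1984, Sect. 2.2 (2.2.5)] [cite: DavisRabinowitz1984, Sect. 2.2 (2.2.6)] -/
theorem integral_eq_simpsonRule_sub_deriv4 {f f₁ f₂ f₃ f₄ : ℝ → ℝ} {a b : ℝ} (hab : a ≤ b) {n : ℕ}
    (hn : 0 < n) (hf : ∀ x ∈ Icc a b, HasDerivAt f (f₁ x) x) (hf₁ : ∀ x ∈ Icc a b, HasDerivAt f₁ (f₂ x) x)
    (hf₂ : ∀ x ∈ Icc a b, HasDerivAt f₂ (f₃ x) x) (hf₃ : ∀ x ∈ Icc a b, HasDerivAt f₃ (f₄ x) x)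
    (hf₄ : ContinuousOn f₄ (Icc a b)) :
    ∃ ξ ∈ Icc a b, ∫ x in a..b, f x = simpsonRule f n a b - (b - a) ^ 5 / (2880 * n ^ 4) * f₄ ξ := by
  have hn' : (0 : ℝ) < n := by exact_mod_cast hn
  obtain ⟨hb, hlohi, hsub⟩ := panel_aux hab hn
  set H : ℝ := (b - a) / n with hH
  have hIab : [[a, b]] = Icc a b := uIcc_of_le hab
  -- per panel (2.2.1)
  have hpanel : ∀ k < n, ∃ ξ ∈ Icc (a + k * H) (a + (k + 1) * H), ∫ t in (a + k * H)..(a + (k + 1) * H), f t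
      = simpson f (a + k * H) (a + (k + 1) * H) - H ^ 5 / 2880 * f₄ ξ := by
    intro k hk
    have hp := integral_eq_simpson_sub_deriv4 (hlohi k) (fun t ht => hf t (hsub k hk ht))
      (fun t ht => hf₁ t (hsub k hk ht)) (fun t ht => hf₂ t (hsub k hk ht)) (fun t ht => hf₃ t (hsub k hk ht))
      (hf₄.mono (hsub k hk))
    rwa [show a + (k + 1) * H - (a + k * H) = H by ring] at hp
  choose! ξ hξmem hξeq using hpanel
  obtain ⟨η, hη, hsum⟩ := exists_sum_eq_card_mul hab hf₄ hn (ξ := ξ) fun k hk => hsub k hk (hξmem k hk)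
  refine ⟨η, hη, ?_⟩
  have hfi : IntervalIntegrable f volume a b :=
    ContinuousOn.intervalIntegrable fun x hx => (hf x (hIab ▸ hx)).continuousAt.continuousWithinAt
  have hS : simpsonRule f n a b = ∑ k ∈ range n, simpson f (a + k * H) (a + (k + 1) * H) := by
    rw [sum_simpson_eq_simpsonRule, hb]
  have hC : H ^ 5 / 2880 * (n * f₄ η) = (b - a) ^ 5 / (2880 * n ^ 4) * f₄ η := by
    rw [hH]
    field_simp
  rw [integral_eq_sum_panels hab hn hfi, hS, sum_congr rfl fun k hk => hξeq k (mem_range.mp hk), sum_sub_distrib,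
    ← mul_sum, hsum, hC]

/-- **One-sided enclosure, upper** (the sign of the error term (2.2.5): `K ≤ 0`): if `f⁽⁴⁾ ≥ 0` on `[a, b]`
(`a ≤ b`, `0 < n`) then `∫_a^b f ≤ S_n(f)` — Simpson's rule overestimates.
[cite: DavisRabinowitz1984, Sect. 2.2 (2.2.5)] [cite: DavisRabinowitz1984, Sect. 4.3 (4.3.19)] -/
theorem integral_le_simpsonRule {f f₁ f₂ f₃ f₄ : ℝ → ℝ} {a b : ℝ} (hab : a ≤ b) {n : ℕ} (hn : 0 < n)
    (hf : ∀ x ∈ Icc a b, HasDerivAt f (f₁ x) x) (hf₁ : ∀ x ∈ Icc a b, HasDerivAt f₁ (f₂ x) x)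
    (hf₂ : ∀ x ∈ Icc a b, HasDerivAt f₂ (f₃ x) x) (hf₃ : ∀ x ∈ Icc a b, HasDerivAt f₃ (f₄ x) x)
    (hf₄ : IntervalIntegrable f₄ volume a b) (hpos : ∀ x ∈ Icc a b, 0 ≤ f₄ x) :
    ∫ x in a..b, f x ≤ simpsonRule f n a b := by
  have hn' : (0 : ℝ) < n := by exact_mod_cast hn
  obtain ⟨hb, hlohi, hsub⟩ := panel_aux hab hn
  set H : ℝ := (b - a) / n with hH
  have hIab : [[a, b]] = Icc a b := uIcc_of_le hab
  have hsub' : ∀ k < n, [[a + k * H, a + (k + 1) * H]] ⊆ [[a, b]] := fun k hk => by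
    rw [uIcc_of_le (hlohi k), hIab]; exact hsub k hk
  have hpanel : ∀ k ∈ range n, ∫ t in (a + k * H)..(a + (k + 1) * H), f t ≤ simpson f (a + k * H) (a + (k + 1) * H) := by
    intro k hk
    rw [Finset.mem_range] at hk
    have hp := integral_sub_simpson_eq_integral_kernel (hlohi k) (fun t ht => hf t (hsub k hk ht))
      (fun t ht => hf₁ t (hsub k hk ht)) (fun t ht => hf₂ t (hsub k hk ht)) (fun t ht => hf₃ t (hsub k hk ht))
      (hf₄.mono_set (hsub' k hk))
    have hK : 0 ≤ ∫ t in (a + k * H)..(a + (k + 1) * H),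
        -(simpsonKernel (a + k * H) (a + (k + 1) * H) t * f₄ t) :=
      intervalIntegral.integral_nonneg (hlohi k) fun t ht =>
        neg_nonneg.2 (mul_nonpos_of_nonpos_of_nonneg (simpsonKernel_nonpos ht) (hpos t (hsub k hk ht)))
    rw [intervalIntegral.integral_neg] at hK
    linarith
  have hfi : IntervalIntegrable f volume a b :=
    ContinuousOn.intervalIntegrable fun x hx => (hf x (hIab ▸ hx)).continuousAt.continuousWithinAt
  have hS : simpsonRule f n a b = ∑ k ∈ range n, simpson f (a + k * H) (a + (k + 1) * H) := by
    rw [sum_simpson_eq_simpsonRule, hb]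
  rw [integral_eq_sum_panels hab hn hfi, hS]
  exact sum_le_sum hpanel

/-- **One-sided enclosure, lower**: if `f⁽⁴⁾ ≤ 0` on `[a, b]` (`a ≤ b`, `0 < n`) then `S_n(f) ≤ ∫_a^b f`.
[cite: DavisRabinowitz1984, Sect. 2.2 (2.2.5)] [cite: DavisRabinowitz1984, Sect. 4.3 (4.3.19)] -/
theorem simpsonRule_le_integral {f f₁ f₂ f₃ f₄ : ℝ → ℝ} {a b : ℝ} (hab : a ≤ b) {n : ℕ} (hn : 0 < n)
    (hf : ∀ x ∈ Icc a b, HasDerivAt f (f₁ x) x) (hf₁ : ∀ x ∈ Icc a b, HasDerivAt f₁ (f₂ x) x)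
    (hf₂ : ∀ x ∈ Icc a b, HasDerivAt f₂ (f₃ x) x) (hf₃ : ∀ x ∈ Icc a b, HasDerivAt f₃ (f₄ x) x)
    (hf₄ : IntervalIntegrable f₄ volume a b) (hneg : ∀ x ∈ Icc a b, f₄ x ≤ 0) :
    simpsonRule f n a b ≤ ∫ x in a..b, f x := by
  have hn' : (0 : ℝ) < n := by exact_mod_cast hn
  obtain ⟨hb, hlohi, hsub⟩ := panel_aux hab hn
  set H : ℝ := (b - a) / n with hH
  have hIab : [[a, b]] = Icc a b := uIcc_of_le hab
  have hsub' : ∀ k < n, [[a + k * H, a + (k + 1) * H]] ⊆ [[a, b]] := fun k hk => by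
    rw [uIcc_of_le (hlohi k), hIab]; exact hsub k hk
  have hpanel : ∀ k ∈ range n, simpson f (a + k * H) (a + (k + 1) * H) ≤ ∫ t in (a + k * H)..(a + (k + 1) * H), f t := by
    intro k hk
    rw [Finset.mem_range] at hk
    have hp := integral_sub_simpson_eq_integral_kernel (hlohi k) (fun t ht => hf t (hsub k hk ht))
      (fun t ht => hf₁ t (hsub k hk ht)) (fun t ht => hf₂ t (hsub k hk ht)) (fun t ht => hf₃ t (hsub k hk ht))
      (hf₄.mono_set (hsub' k hk))
    have hK : 0 ≤ ∫ t in (a + k * H)..(a + (k + 1) * H),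
        simpsonKernel (a + k * H) (a + (k + 1) * H) t * f₄ t :=
      intervalIntegral.integral_nonneg (hlohi k) fun t ht =>
        mul_nonneg_of_nonpos_of_nonpos (simpsonKernel_nonpos ht) (hneg t (hsub k hk ht))
    linarith
  have hfi : IntervalIntegrable f volume a b :=
    ContinuousOn.intervalIntegrable fun x hx => (hf x (hIab ▸ hx)).continuousAt.continuousWithinAt
  have hS : simpsonRule f n a b = ∑ k ∈ range n, simpson f (a + k * H) (a + (k + 1) * H) := by
    rw [sum_simpson_eq_simpsonRule, hb]
  rw [integral_eq_sum_panels hab hn hfi, hS]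
  exact sum_le_sum hpanel

end

end Literature.Analysis.Quadrature
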